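import Mathlib
import Literature.Analysis.Matrix.KatoSemisimpleFirstOrderProofs
import Literature.MathematicalPhysics.QuantumLattice.SectorSpectrum
import HarnessLib

/-!
# The pointwise Zeno (strong-measurement) limit for `B + i y Π` via Kato's reduction process

Topic `Literature/Analysis/Matrix`; a corollary of T. Kato, *Perturbation Theory for Linear
Operators* (1966), Ch. II §2.3 Thm 2.3 (first-order splitting at a semisimple eigenvalue, discharged
in `KatoSemisimpleFirstOrderProofs.lean`), in the form used by route `HubbardSuperconductivity/KkFloor`
(item `KkShelfNeedsVacuumGap`):

`re_rayleigh_ge_of_shelf`: on a finite index type let `B`, `Π` be Hermitian and suppose that for all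
`y ≥ Y` every eigenvalue of `B + i y Π` has real part `≥ m₀`; then `m₀ ≤ Re ⟨v, B v⟩` for every
unit vector `v` with `Π v = 0`.

Proof: diagonalise `Π = U D U*` (`Matrix.IsHermitian.spectral_theorem`); the kernel of `D` is a
coordinate block on which the compression of `B' = U* B U` is a Hermitian matrix with lowest
eigenvalue `μ₀ ≤ Re ⟨v, B v⟩` (`Matrix.groundEnergy_le_rayleigh_holds`,
`Matrix.groundSpace_ne_bot_holds` of `QuantumLattice/FinDimSpectrumProofs`); `0` is a semisimple
eigenvalue of `D` (`isCompl_ker_range_diagonal`) and `μ₀` an eigenvalue of Kato's compression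
`P B'|_{ker D}`, so by `Kato1966_II_thm_2_3_holds` the matrix `D + κ B'`, `κ = -i/y`, has an
eigenvalue `κ μ₀ + o(κ)`; multiplying by `i y` and transporting the eigenvector by `U` gives an
eigenvector of `B + i y Π` with eigenvalue `μ₀ + o(1)`, whence `m₀ ≤ μ₀ + ε` for every `ε > 0`
("as `y → ∞` exactly `dim ker Π` eigenvalues of `B + iyΠ` converge to the spectrum of the
compression of `B` to `ker Π`", Kato II-§2.3). No definitions.
-/

noncomputable section

namespace Literature.Analysis.Matrix

open _root_.Matrix Complex Module.End
open Literature.MathematicalPhysics.QuantumLattice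
open scoped ComplexOrder


open _root_.Matrix Complex Module.End
open Literature.MathematicalPhysics.QuantumLattice
open scoped ComplexOrder

section Core

variable {S : Type*} [Fintype S] [DecidableEq S]

/-- Kernel and range of (the linear map of) a real diagonal matrix are complementary subspaces:
`0` is a semisimple eigenvalue of a diagonal matrix. [folklore] -/
theorem isCompl_ker_range_diagonal (d : S → ℝ) :
    IsCompl (LinearMap.ker (Matrix.toLin' (diagonal (fun i => (d i : ℂ)) - (0 : ℂ) • (1 : Matrix S S ℂ))))
      (LinearMap.range (Matrix.toLin' (diagonal (fun i => (d i : ℂ)) - (0 : ℂ) • (1 : Matrix S S ℂ)))) := by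
  simp only [zero_smul, sub_zero]
  rw [isCompl_iff]
  constructor
  · rw [Submodule.disjoint_def]
    intro w hw hw'
    rw [LinearMap.mem_ker, Matrix.toLin'_apply] at hw
    obtain ⟨x, hx⟩ := LinearMap.mem_range.mp hw'
    rw [Matrix.toLin'_apply] at hx
    funext i
    have h1 := congrFun hw i
    have h2 := congrFun hx i
    simp only [mulVec_diagonal, Pi.zero_apply] at h1 h2
    rw [← h2] at h1 ⊢
    rcases mul_eq_zero.mp h1 with h | h
    · rw [h, zero_mul]; rfl
    · rw [h]; rfl
  · rw [codisjoint_iff_le_sup]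
    intro w _
    set w0 : S → ℂ := fun i => if d i = 0 then w i else 0 with hw0
    set w1 : S → ℂ := fun i => if d i = 0 then 0 else w i with hw1
    have hw : w = w0 + w1 := by
      funext i
      by_cases h : d i = 0 <;> simp [hw0, hw1, h]
    rw [hw]
    refine Submodule.add_mem_sup ?_ ?_
    · rw [LinearMap.mem_ker, Matrix.toLin'_apply]
      funext i
      by_cases h : d i = 0 <;> simp [mulVec_diagonal, hw0, h]
    · rw [LinearMap.mem_range]
      refine ⟨fun i => if d i = 0 then 0 else w i / d i, ?_⟩
      rw [Matrix.toLin'_apply]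
      funext i
      by_cases h : d i = 0
      · simp [mulVec_diagonal, hw1, h]
      · have hd : (d i : ℂ) ≠ 0 := by exact_mod_cast h
        simp [mulVec_diagonal, hw1, h]
        field_simp

omit [DecidableEq S] in
/-- Conjugating a sandwich by a matrix: `⟨U w, X (U w)⟩ = ⟨w, (U* X U) w⟩`. [folklore] -/
theorem star_mulVec_dotProduct_mulVec (U X : Matrix S S ℂ) (w : S → ℂ) :
    star (U *ᵥ w) ⬝ᵥ (X *ᵥ (U *ᵥ w)) = star w ⬝ᵥ ((star U * X * U) *ᵥ w) := by
  rw [star_mulVec, ← dotProduct_mulVec, mulVec_mulVec, mulVec_mulVec, star_eq_conjTranspose,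
    Matrix.mul_assoc]

/-- **The pointwise Zeno limit, abstract form.** Let `B` be Hermitian and `Q` Hermitian on a
finite index type, and suppose that for all `y ≥ Y` every eigenvalue `λ` of `B + i y Q` has
`Re λ ≥ m₀`. Then `m₀ ≤ Re ⟨v, B v⟩` for every unit vector `v` with `Q v = 0`.
Proof: diagonalise `Q = U D U*`; in the kernel block of `D` the compression of `B' = U* B U` is a
Hermitian matrix whose lowest eigenvalue `μ₀` bounds the Rayleigh quotient of `v` from below; by
Kato's first-order splitting at the semisimple eigenvalue `0` of `D`
(`Literature.Analysis.Matrix.Kato1966_II_thm_2_3_holds`, with `κ = -i/y`) the matrix `B' + i y D`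
has, for large `y`, an eigenvalue `μ₀ + o(1)`; transporting its eigenvector by `U` and applying the
hypothesis gives `m₀ ≤ μ₀ + ε` for every `ε > 0`. (Kato 1966, II-§2.3 Thm 2.3 "reduction
process".) [cite: Kato1966, Thm II-2.3] -/
theorem re_rayleigh_ge_of_shelf (B Q : Matrix S S ℂ) (hB : B.IsHermitian) (hQ : Q.IsHermitian)
    (m₀ Y : ℝ)
    (hshelf : ∀ y : ℝ, Y ≤ y → ∀ v : S → ℂ, v ≠ 0 → ∀ lam : ℂ,
      (B + (Complex.I * (y : ℂ)) • Q) *ᵥ v = lam • v → m₀ ≤ lam.re)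
    (v : S → ℂ) (hv1 : star v ⬝ᵥ v = 1) (hv : Q *ᵥ v = 0) :
    m₀ ≤ (star v ⬝ᵥ B *ᵥ v).re := by
  classical
  -- diagonalise `Q`
  set U : Matrix S S ℂ := (hQ.eigenvectorUnitary : Matrix S S ℂ) with hU
  set d : S → ℝ := hQ.eigenvalues with hd
  set D : Matrix S S ℂ := diagonal (fun i => (d i : ℂ)) with hD
  have hUU : U * star U = 1 := Matrix.mem_unitaryGroup_iff.mp hQ.eigenvectorUnitary.2
  have hU'U : star U * U = 1 := Matrix.mem_unitaryGroup_iff'.mp hQ.eigenvectorUnitary.2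
  have hQeq : Q = U * D * star U := by
    have h := hQ.spectral_theorem
    rw [Unitary.conjStarAlgAut_apply] at h
    exact h
  have hDeq : D = star U * Q * U := by
    rw [hQeq]
    calc D = (star U * U) * D * (star U * U) := by rw [hU'U, Matrix.one_mul, Matrix.mul_one]
      _ = star U * (U * D * star U) * U := by simp only [Matrix.mul_assoc]
  set B' : Matrix S S ℂ := star U * B * U with hB'
  have hB'h : B'.IsHermitian := by
    have := Matrix.isHermitian_conjTranspose_mul_mul U hB
    simpa [hB', Matrix.star_eq_conjTranspose] using this
  -- the transported vector
  set v' : S → ℂ := star U *ᵥ v with hv'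
  have hUv' : U *ᵥ v' = v := by rw [hv', mulVec_mulVec, hUU, one_mulVec]
  have hv'1 : star v' ⬝ᵥ v' = 1 := by
    have := star_mulVec_dotProduct_mulVec U 1 v'
    rw [hUv', one_mulVec, Matrix.mul_one, hU'U, one_mulVec] at this
    rw [← this, hv1]
  have hray : star v ⬝ᵥ B *ᵥ v = star v' ⬝ᵥ B' *ᵥ v' := by
    have := star_mulVec_dotProduct_mulVec U B v'
    rw [hUv'] at this
    rw [this]
  have hDv' : D *ᵥ v' = 0 := by
    rw [hDeq, ← mulVec_mulVec, ← mulVec_mulVec, hUv', hv, mulVec_zero]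
  have hsupp : ∀ i, d i ≠ 0 → v' i = 0 := by
    intro i hi
    have := congrFun hDv' i
    simp only [hD, mulVec_diagonal, Pi.zero_apply, mul_eq_zero, Complex.ofReal_eq_zero] at this
    exact this.resolve_left hi
  -- the kernel block
  set p : S → Prop := fun i => d i = 0 with hp
  set ext : ({i // p i} → ℂ) → (S → ℂ) := fun φ i => if h : p i then φ ⟨i, h⟩ else 0 with hext
  set res : (S → ℂ) → ({i // p i} → ℂ) := fun w a => w a.1 with hres
  have hext_apply : ∀ φ (a : {i // p i}), ext φ a.1 = φ a := fun φ a => by simp [hext, a.2]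
  have hext_not : ∀ φ i, ¬ p i → ext φ i = 0 := fun φ i hi => by simp [hext, hi]
  set B₀ : Matrix {i // p i} {i // p i} ℂ := B'.submatrix Subtype.val Subtype.val with hB₀
  have hB₀h : B₀.IsHermitian := hB'h.submatrix _
  set u : {i // p i} → ℂ := res v' with hu
  have hv'supp : ∀ i, ¬ p i → v' i = 0 := fun i hi => hsupp i hi
  have hu1 : star u ⬝ᵥ u = 1 := by
    rw [← hv'1, dotProduct, dotProduct,
      sum_eq_sum_subtype_of_support p (fun i => star v' i * v' i)
        (fun i hi => by rw [Pi.star_apply, hv'supp i hi, star_zero, zero_mul])]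
    rfl
  have hB₀u : ∀ a : {i // p i}, (B₀ *ᵥ u) a = (B' *ᵥ v') a.1 := by
    intro a
    rw [mulVec, mulVec, dotProduct, dotProduct,
      sum_eq_sum_subtype_of_support p (fun j => B' a.1 j * v' j)
        (fun j hj => by rw [hv'supp j hj, mul_zero])]
    rfl
  have hray' : star v' ⬝ᵥ B' *ᵥ v' = star u ⬝ᵥ B₀ *ᵥ u := by
    rw [dotProduct, dotProduct,
      sum_eq_sum_subtype_of_support p (fun i => star v' i * (B' *ᵥ v') i)
        (fun i hi => by rw [Pi.star_apply, hv'supp i hi, star_zero, zero_mul])]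
    refine Finset.sum_congr rfl fun a _ => ?_
    rw [hB₀u a]
    rfl
  -- nonempty kernel block
  have hv'ne : v' ≠ 0 := by
    intro h0
    rw [h0, dotProduct_zero] at hv'1
    exact zero_ne_one hv'1
  obtain ⟨i₀, hi₀⟩ : ∃ i, p i := by
    by_contra hno
    push Not at hno
    exact hv'ne (funext fun i => hv'supp i (hno i))
  haveI : Nonempty {i // p i} := ⟨⟨i₀, hi₀⟩⟩
  -- the lowest eigenvalue of the kernel block
  set μ₀ : ℝ := B₀.groundEnergy with hμ₀
  have hμ₀le : μ₀ ≤ (star u ⬝ᵥ B₀ *ᵥ u).re := Matrix.groundEnergy_le_rayleigh_holds hB₀h u hu1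
  rw [hray, hray']
  refine le_trans ?_ hμ₀le
  -- an eigenvector of the kernel block for `μ₀`
  obtain ⟨u₀, hu₀mem, hu₀ne⟩ :=
    (Submodule.ne_bot_iff _).1 (Matrix.groundSpace_ne_bot_holds hB₀h)
  rw [Matrix.mem_groundSpace_iff] at hu₀mem
  -- Kato's setting: `T = D`, `λ = 0`, `T₁ = B'`
  have hc := isCompl_ker_range_diagonal (S := S) d
  set f := Matrix.toLin' (D - (0 : ℂ) • (1 : Matrix S S ℂ)) with hf
  have hfD : ∀ w, f w = D *ᵥ w := fun w => by simp [hf]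
  set x : S → ℂ := ext u₀ with hx
  have hxK : x ∈ LinearMap.ker f := by
    rw [LinearMap.mem_ker, hfD]
    funext i
    by_cases h : p i
    · have : d i = 0 := h
      simp [hD, mulVec_diagonal, this]
    · simp [hD, mulVec_diagonal, hx, hext_not u₀ i h]
  have hxne : x ≠ 0 := by
    intro h0
    apply hu₀ne
    funext a
    have := congrFun h0 a.1
    rwa [hx, hext_apply] at this
  -- the compression `P B'|_{ker D}` has eigenvalue `μ₀` at `x`
  set P := (LinearMap.ker f).projectionOnto (LinearMap.range f) hc with hPdef
  have hw0 : ∀ i, p i → (B' *ᵥ x) i = (μ₀ : ℂ) * x i := by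
    intro i hi
    have h1 : (B' *ᵥ x) i = (B₀ *ᵥ u₀) ⟨i, hi⟩ := by
      rw [mulVec, mulVec, dotProduct, dotProduct,
        sum_eq_sum_subtype_of_support p (fun j => B' i j * x j)
          (fun j hj => by rw [hx, hext_not u₀ j hj, mul_zero])]
      refine Finset.sum_congr rfl fun a _ => ?_
      rw [hx, hext_apply]
      rfl
    rw [h1, hu₀mem, Pi.smul_apply, smul_eq_mul, hx, hext_apply u₀ ⟨i, hi⟩]
  have hPBx : P (B' *ᵥ x) = (μ₀ : ℂ) • ⟨x, hxK⟩ := by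
    set w := B' *ᵥ x with hw
    set w1 : S → ℂ := fun i => if p i then 0 else w i with hw1
    have hsplit : w = (μ₀ : ℂ) • x + w1 := by
      funext i
      by_cases h : p i
      · simp [hw1, h, hw0 i h]
      · simp [hw1, h, hx, hext_not u₀ i h]
    have hw1R : w1 ∈ LinearMap.range f := by
      rw [LinearMap.mem_range]
      refine ⟨fun i => if p i then 0 else w i / d i, ?_⟩
      rw [hfD]
      funext i
      by_cases h : p i
      · simp [hD, mulVec_diagonal, hw1, h]
      · have hd0 : (d i : ℂ) ≠ 0 := by exact_mod_cast h
        simp [hD, mulVec_diagonal, hw1, h]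
        field_simp
    rw [hsplit, map_add, (Submodule.projectionOnto_apply_eq_zero_iff hc).mpr hw1R, add_zero,
      map_smul, Submodule.projectionOnto_apply_of_mem_left hc hxK]
  have hμ₀eig : HasEigenvalue (P ∘ₗ (Matrix.toLin' B' ∘ₗ (LinearMap.ker f).subtype)) (μ₀ : ℂ) := by
    refine hasEigenvalue_of_hasEigenvector (x := ⟨x, hxK⟩) ⟨?_, fun h => hxne (congrArg Subtype.val h)⟩
    rw [mem_eigenspace_iff]
    simp only [LinearMap.coe_comp, Function.comp_apply, Submodule.coe_subtype, Matrix.toLin'_apply]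
    exact hPBx
  -- conclude: `m₀ ≤ μ₀ + ε` for every `ε > 0`
  refine le_of_forall_pos_le_add fun ε hε => ?_
  obtain ⟨δ, hδ, hK⟩ :=
    Literature.Analysis.Matrix.Kato1966_II_thm_2_3_holds D B' 0 hc (μ₀ : ℂ) hμ₀eig ε hε
  set y : ℝ := max Y (2 / δ) with hy
  have hyY : Y ≤ y := le_max_left _ _
  have hy0 : 0 < y := lt_of_lt_of_le (by positivity) (le_max_right _ _)
  have hyδ : 1 / y < δ := by
    have h2 : 2 / δ ≤ y := le_max_right _ _
    rw [div_lt_iff₀ hy0]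
    have : 2 ≤ δ * y := by
      calc (2 : ℝ) = δ * (2 / δ) := by field_simp
        _ ≤ δ * y := mul_le_mul_of_nonneg_left h2 hδ.le
    linarith
  set κ : ℂ := -Complex.I / (y : ℂ) with hκ
  have hyc : (y : ℂ) ≠ 0 := by exact_mod_cast hy0.ne'
  have hκnorm : ‖κ‖ = 1 / y := by
    rw [hκ, norm_div, norm_neg, Complex.norm_I, Complex.norm_real, Real.norm_eq_abs,
      abs_of_pos hy0]
  have hIyκ : Complex.I * (y : ℂ) * κ = 1 := by
    rw [hκ]
    field_simp
    simp [Complex.I_sq]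
  obtain ⟨ν, hν, hνμ⟩ := hK κ (by rw [hκnorm]; exact hyδ)
  obtain ⟨v'', hv''⟩ := hν.exists_hasEigenvector
  have hv''ne : v'' ≠ 0 := hv''.2
  have hv''eq : (D + κ • B') *ᵥ v'' = ν • v'' := by
    have := hv''.1
    rw [mem_eigenspace_iff, Matrix.toLin'_apply] at this
    exact this
  -- the eigen-equation for `B' + i y D`, then for `B + i y Q` at `U v''`
  have hmat : B' + (Complex.I * (y : ℂ)) • D = (Complex.I * (y : ℂ)) • (D + κ • B') := by
    rw [smul_add, smul_smul, hIyκ, one_smul, add_comm]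
  have heq' : (B' + (Complex.I * (y : ℂ)) • D) *ᵥ v'' = (Complex.I * (y : ℂ) * ν) • v'' := by
    rw [hmat, smul_mulVec, hv''eq, smul_smul]
  have hconj : B + (Complex.I * (y : ℂ)) • Q = U * (B' + (Complex.I * (y : ℂ)) • D) * star U := by
    rw [Matrix.mul_add, Matrix.add_mul, Matrix.mul_smul, Matrix.smul_mul, ← hQeq, hB']
    congr 1
    calc B = (U * star U) * B * (U * star U) := by rw [hUU, Matrix.one_mul, Matrix.mul_one]
      _ = U * (star U * B * U) * star U := by simp only [Matrix.mul_assoc]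
  have hUv''ne : U *ᵥ v'' ≠ 0 := by
    intro h0
    apply hv''ne
    have := congrArg (fun w => star U *ᵥ w) h0
    simpa [mulVec_mulVec, hU'U] using this
  have heq : (B + (Complex.I * (y : ℂ)) • Q) *ᵥ (U *ᵥ v'') =
      (Complex.I * (y : ℂ) * ν) • (U *ᵥ v'') := by
    rw [hconj, ← mulVec_mulVec, ← mulVec_mulVec, mulVec_mulVec v'' (star U) U, hU'U, one_mulVec,
      heq', mulVec_smul]
  have hm := hshelf y hyY (U *ᵥ v'') hUv''ne _ heq
  -- `Re (i y ν) ≤ μ₀ + ε`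
  have hdecomp : Complex.I * (y : ℂ) * ν = (μ₀ : ℂ) + Complex.I * (y : ℂ) * (ν - 0 - κ * (μ₀ : ℂ)) := by
    have : Complex.I * (y : ℂ) * (κ * (μ₀ : ℂ)) = (μ₀ : ℂ) := by
      rw [← mul_assoc, hIyκ, one_mul]
    linear_combination this
  have hbound : (Complex.I * (y : ℂ) * ν).re ≤ μ₀ + ε := by
    rw [hdecomp, Complex.add_re, Complex.ofReal_re]
    refine add_le_add le_rfl ?_
    calc (Complex.I * (y : ℂ) * (ν - 0 - κ * (μ₀ : ℂ))).re
        ≤ ‖Complex.I * (y : ℂ) * (ν - 0 - κ * (μ₀ : ℂ))‖ := Complex.re_le_norm _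
      _ = y * ‖ν - 0 - κ * (μ₀ : ℂ)‖ := by
          rw [norm_mul, norm_mul, Complex.norm_I, one_mul, Complex.norm_real, Real.norm_eq_abs,
            abs_of_pos hy0]
      _ ≤ y * (ε * ‖κ‖) := mul_le_mul_of_nonneg_left hνμ hy0.le
      _ = ε := by rw [hκnorm]; field_simp
  exact hm.trans hbound

end Core

end Literature.Analysis.Matrix
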